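import Summits.Ventures.DiscreteObjects.Hadamard.PrimeOrderAutomorphism
import Literature.Combinatorics.Designs.GoethalsSeidelArray

/-!
# Hadamard 668 census, family F12 — automorphisms of a Hadamard matrix of order 668 transfer to the
# normalised 2-(667,333,166) structure (kernel); no automorphism of prime order p for 105 primes

Framing: lottery ticket; floor = certified bounds/negative ranges.

Cell pub-namedobj (venture DiscreteObjects), target (H), hadamard gen 6.  `PrimeOrderAutomorphism` proved, fully in the
kernel, that a `0/1` incidence function with `|B| = 667`, row sums `333` and inner product `166` between distinct rows
admits no automorphism pair `(ρ, τ)` with `ρ^p = τ^p = 1`, `ρ ≠ 1`, for the 106 odd primes `p ∈ [43, 661] ∖ {47, 83}`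
(`no_automorphism_primes106`).  The step 'an automorphism of a HADAMARD MATRIX of order 668 gives such a pair' was on
paper (module docstring there; FAMILY-F12 §6).  This file proves it:

* a SIGNED-PERMUTATION AUTOMORPHISM of a `±1` matrix `H` is `(π, κ, d, e)` with `H (π i) (κ j) = d i * e j * H i j`,
  signs `d i, e j ∈ {±1}` (`IsSignedAut`; this is `P H Qᵀ = H` for the signed permutation matrices `P, Q`);
* if `π r = r` and `κ c = c`, the matrix normalised at `(r, c)`, `H r c * H r j * H i c * H i j`, is invariant under
  `(π, κ)` (`nrm_aut`), has row `r` and column `c` constant `1`, and for a Hadamard matrix of order `668` its `+1`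
  pattern off row `r` / column `c` is a `0/1` incidence function on `{i // i ≠ r} × {j // j ≠ c}` with row sums `333`
  and distinct-row inner products `166` (`inc_rowsum`, `inc_pair`) carrying the automorphism pair
  `(π.subtypePerm, κ.subtypePerm)`;
* hence (`no_hadamard668_signedAut_of_fixed`) no Hadamard matrix of order `668` has a signed automorphism with
  `π^p = κ^p = 1`, `π ≠ 1`, a fixed row and a fixed column, for `p ∈ primes106`; and since a permutation with `π^p = 1`,
  `p ∤ 668`, has a fixed point (Mathlib `Equiv.Perm.exists_fixed_point_of_prime`), **no Hadamard matrix of order 668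
  has a nontrivial signed automorphism `(π, κ, d, e)` with `π^p = κ^p = 1` for any of the 105 primes
  `p ∈ [43, 661] ∖ {47, 83, 167}`** (`no_hadamard668_signedAut_primes105`; nontrivial = `π ≠ 1 ∨ κ ≠ 1`, the case
  `π = 1` being reduced by `signedAut_snd_eq_one`: column orthogonality `Hᵀ H = n I`, derived here from `H Hᵀ = n I`
  over `ℤ` via the adjugate, forces `κ² = 1`, so `κ = 1` for odd `p`).
Everything is in the kernel: no design theory, no parity theorem, no table beyond `primes106_disc` of the imported file.
Ours, not literature; no `sorry`, `decide` only for `p ∤ 668` over the list.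
-/

open Finset BigOperators Matrix

namespace Summit.Ventures.DiscreteObjects.Hadamard

open Literature.Combinatorics.Designs.GoethalsSeidel (IsHadamardMatrix)

variable {ι : Type*} [Fintype ι] [DecidableEq ι]

/-- `(π, κ, d, e)` is a signed-permutation automorphism of the integer matrix `H`: `H (π i) (κ j) = d i * e j * H i j`
with signs `d i, e j ∈ {1, -1}` (equivalently `P H Qᵀ = H` for the signed permutation matrices built from `(d, π)` and
`(e, κ)`). -/
def IsSignedAut (H : Matrix ι ι ℤ) (π κ : Equiv.Perm ι) (d e : ι → ℤ) : Prop :=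
  (∀ i, d i = 1 ∨ d i = -1) ∧ (∀ j, e j = 1 ∨ e j = -1) ∧ ∀ i j, H (π i) (κ j) = d i * e j * H i j

section hadamard
variable (H : Matrix ι ι ℤ)

/-- a `±1` value squares to `1` -/
lemma pm_mul_self {a : ℤ} (h : a = 1 ∨ a = -1) : a * a = 1 := by
  rcases h with rfl | rfl <;> norm_num

/-- a `±1` value is nonzero -/
lemma pm_ne_zero {a : ℤ} (h : a = 1 ∨ a = -1) : a ≠ 0 := by
  rcases h with rfl | rfl <;> norm_num

/-- distinct rows of a Hadamard matrix are orthogonal -/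
lemma hadamard_row_orth (hH : IsHadamardMatrix H) {i i' : ι} (h : i ≠ i') : ∑ j, H i j * H i' j = 0 := by
  have e := congrFun (congrFun hH.2 i) i'
  rw [Matrix.mul_apply] at e
  simpa [Matrix.transpose_apply, Matrix.smul_apply, Matrix.one_apply_ne h] using e

/-- a row of a Hadamard matrix has squared norm equal to the order -/
lemma hadamard_row_self (hH : IsHadamardMatrix H) (i : ι) : ∑ j, H i j * H i j = Fintype.card ι := by
  have e := congrFun (congrFun hH.2 i) i
  rw [Matrix.mul_apply] at e
  simpa [Matrix.transpose_apply, Matrix.smul_apply, Matrix.one_apply_eq] using e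

/-- `Hᵀ H = n I` follows from `H Hᵀ = n I` over `ℤ` (cancel `H` with the adjugate; `det H ≠ 0`) -/
lemma transpose_mul_self_of_mul_transpose (n : ℤ) (hn : n ≠ 0) (h : H * Hᵀ = n • (1 : Matrix ι ι ℤ)) :
    Hᵀ * H = n • (1 : Matrix ι ι ℤ) := by
  have hdet : H.det ≠ 0 := by
    intro h0
    have e := congrArg Matrix.det h
    rw [Matrix.det_mul, Matrix.det_transpose, h0, zero_mul, Matrix.det_smul, Matrix.det_one, mul_one] at e
    exact pow_ne_zero _ hn e.symm
  have hz : H * (Hᵀ * H - n • (1 : Matrix ι ι ℤ)) = 0 := by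
    rw [Matrix.mul_sub, ← Matrix.mul_assoc, h, Matrix.smul_mul, Matrix.mul_smul, Matrix.one_mul, Matrix.mul_one,
      sub_self]
  have hs : H.det • (Hᵀ * H - n • (1 : Matrix ι ι ℤ)) = 0 := by
    calc H.det • (Hᵀ * H - n • (1 : Matrix ι ι ℤ))
        = (H.adjugate * H) * (Hᵀ * H - n • (1 : Matrix ι ι ℤ)) := by
          rw [Matrix.adjugate_mul, Matrix.smul_mul, Matrix.one_mul]
      _ = H.adjugate * (H * (Hᵀ * H - n • (1 : Matrix ι ι ℤ))) := by rw [Matrix.mul_assoc]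
      _ = 0 := by rw [hz, Matrix.mul_zero]
  rcases smul_eq_zero.mp hs with h0 | h0
  · exact absurd h0 hdet
  · exact sub_eq_zero.mp h0

/-- distinct columns of a Hadamard matrix are orthogonal -/
lemma hadamard_col_orth (hH : IsHadamardMatrix H) (hcard : (Fintype.card ι : ℤ) ≠ 0) {j j' : ι} (h : j ≠ j') :
    ∑ i, H i j * H i j' = 0 := by
  have hT := transpose_mul_self_of_mul_transpose H _ hcard hH.2
  have e := congrFun (congrFun hT j) j'
  rw [Matrix.mul_apply] at e
  simpa [Matrix.transpose_apply, Matrix.smul_apply, Matrix.one_apply_ne h] using e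

/-- **The row permutation controls the column permutation.** If `(1, κ, d, e)` is a signed automorphism of a
Hadamard matrix (row permutation trivial) then `κ² = 1`; so if `κ^p = 1` with `p` odd then `κ = 1`.  (Column `κ² j`
equals `±` column `j`, and distinct columns are orthogonal.) -/
theorem signedAut_snd_eq_one (hH : IsHadamardMatrix H) (hcard : (Fintype.card ι : ℤ) ≠ 0)
    {κ : Equiv.Perm ι} {d e : ι → ℤ} (haut : IsSignedAut H 1 κ d e) {p : ℕ} (hp : Odd p) (hκ : κ ^ p = 1) :
    κ = 1 := by
  obtain ⟨hd, he, hA⟩ := haut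
  -- κ² = 1 pointwise
  have hsq : ∀ j, κ (κ j) = j := by
    intro j
    by_contra hne
    -- column κ² j = (e (κ j) * e j) • column j
    have col : ∀ i, H i (κ (κ j)) = e (κ j) * e j * H i j := by
      intro i
      have h1 := hA i (κ j)
      have h2 := hA i j
      simp only [Equiv.Perm.coe_one, id_eq] at h1 h2
      rw [h1, h2]
      have := pm_mul_self (hd i)
      calc d i * e (κ j) * (d i * e j * H i j) = (d i * d i) * (e (κ j) * e j * H i j) := by ring
        _ = e (κ j) * e j * H i j := by rw [this, one_mul]
    have orth := hadamard_col_orth H hH hcard hne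
    have hval : ∑ i, H i (κ (κ j)) * H i j = e (κ j) * e j * Fintype.card ι := by
      rw [show ∑ i, H i (κ (κ j)) * H i j = ∑ i, e (κ j) * e j * (H i j * H i j) from
        Finset.sum_congr rfl fun i _ => by rw [col i]; ring]
      rw [← Finset.mul_sum]
      congr 1
      -- the column version of the norm identity: Σ_i H i j * H i j = n
      have hT := transpose_mul_self_of_mul_transpose H _ hcard hH.2
      have e3 := congrFun (congrFun hT j) j
      rw [Matrix.mul_apply] at e3
      simpa [Matrix.transpose_apply, Matrix.smul_apply, Matrix.one_apply_eq] using e3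
    rw [hval] at orth
    have hs : e (κ j) * e j ≠ 0 := mul_ne_zero (pm_ne_zero (he (κ j))) (pm_ne_zero (he j))
    exact (mul_ne_zero hs hcard) orth
  have hκ2 : κ ^ 2 = 1 := by
    ext j; simp [pow_two, hsq j]
  obtain ⟨k, rfl⟩ := hp
  rw [pow_succ, pow_mul, hκ2, one_pow, one_mul] at hκ
  exact hκ

end hadamard

section normalise
variable (H : Matrix ι ι ℤ) (r c : ι)

/-- the matrix normalised at row `r` and column `c`: `H r c * H r j * H i c * H i j` -/
def nrm (i j : ι) : ℤ := H r c * H r j * H i c * H i j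

/-- the `+1` pattern of the normalised matrix as a `0/1` integer -/
def inc (i j : ι) : ℤ := if nrm H r c i j = 1 then 1 else 0

variable {H r c}

/-- normalised entries are `±1` -/
lemma nrm_pm (hH : IsHadamardMatrix H) (i j : ι) : nrm H r c i j = 1 ∨ nrm H r c i j = -1 := by
  unfold nrm
  rcases hH.1 r c with h1 | h1 <;> rcases hH.1 r j with h2 | h2 <;> rcases hH.1 i c with h3 | h3 <;>
    rcases hH.1 i j with h4 | h4 <;> rw [h1, h2, h3, h4] <;> norm_num

/-- row `r` of the normalised matrix is constant `1` -/
lemma nrm_row (hH : IsHadamardMatrix H) (j : ι) : nrm H r c r j = 1 := by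
  unfold nrm
  have h1 := pm_mul_self (hH.1 r c)
  have h2 := pm_mul_self (hH.1 r j)
  calc H r c * H r j * H r c * H r j = (H r c * H r c) * (H r j * H r j) := by ring
    _ = 1 := by rw [h1, h2, one_mul]

/-- column `c` of the normalised matrix is constant `1` -/
lemma nrm_col (hH : IsHadamardMatrix H) (i : ι) : nrm H r c i c = 1 := by
  unfold nrm
  have h1 := pm_mul_self (hH.1 r c)
  have h2 := pm_mul_self (hH.1 i c)
  calc H r c * H r c * H i c * H i c = (H r c * H r c) * (H i c * H i c) := by ring
    _ = 1 := by rw [h1, h2, one_mul]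

/-- distinct rows of the normalised matrix are orthogonal -/
lemma nrm_orth (hH : IsHadamardMatrix H) {i i' : ι} (h : i ≠ i') : ∑ j, nrm H r c i j * nrm H r c i' j = 0 := by
  have key : ∀ j, nrm H r c i j * nrm H r c i' j = (H i c * H i' c) * (H i j * H i' j) := by
    intro j
    unfold nrm
    have h1 := pm_mul_self (hH.1 r c)
    have h2 := pm_mul_self (hH.1 r j)
    calc H r c * H r j * H i c * H i j * (H r c * H r j * H i' c * H i' j)
        = (H r c * H r c) * (H r j * H r j) * ((H i c * H i' c) * (H i j * H i' j)) := by ring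
      _ = (H i c * H i' c) * (H i j * H i' j) := by rw [h1, h2, one_mul, one_mul]
  rw [Finset.sum_congr rfl fun j _ => key j, ← Finset.mul_sum, hadamard_row_orth H hH h, mul_zero]

/-- rows other than `r` of the normalised matrix sum to `0` -/
lemma nrm_rowsum (hH : IsHadamardMatrix H) {i : ι} (h : i ≠ r) : ∑ j, nrm H r c i j = 0 := by
  have e := nrm_orth (r := r) (c := c) hH h
  rw [Finset.sum_congr rfl fun j _ => by rw [nrm_row (r := r) (c := c) hH j, mul_one]] at e
  exact e

omit [Fintype ι] [DecidableEq ι] in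
/-- **Invariance.** A signed automorphism fixing row `r` and column `c` preserves the normalised matrix. -/
lemma nrm_aut {π κ : Equiv.Perm ι} {d e : ι → ℤ} (haut : IsSignedAut H π κ d e)
    (hr : π r = r) (hc : κ c = c) (i j : ι) : nrm H r c (π i) (κ j) = nrm H r c i j := by
  obtain ⟨hd, he, hA⟩ := haut
  unfold nrm
  have h1 : H r (κ j) = d r * e j * H r j := by rw [← hA r j, hr]
  have h2 : H (π i) c = d i * e c * H i c := by rw [← hA i c, hc]
  have h3 : H (π i) (κ j) = d i * e j * H i j := hA i j
  have h4 : d r * e c * H r c = H r c := by rw [← hA r c, hr, hc]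
  have hd2 := pm_mul_self (hd i)
  have he2 := pm_mul_self (he j)
  rw [h1, h2, h3]
  calc H r c * (d r * e j * H r j) * (d i * e c * H i c) * (d i * e j * H i j)
      = (d r * e c * H r c) * H r j * H i c * H i j * (d i * d i) * (e j * e j) := by ring
    _ = H r c * H r j * H i c * H i j := by rw [h4, hd2, he2, mul_one, mul_one]

omit [Fintype ι] [DecidableEq ι] in
/-- `inc` is `0/1` -/
lemma inc_01 (i j : ι) : inc H r c i j = 0 ∨ inc H r c i j = 1 := by
  unfold inc; split_ifs <;> simp

/-- `2 · inc = 1 + nrm` -/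
lemma two_mul_inc (hH : IsHadamardMatrix H) (i j : ι) : 2 * inc H r c i j = 1 + nrm H r c i j := by
  unfold inc
  rcases nrm_pm (r := r) (c := c) hH i j with h | h
  · rw [if_pos h, h]; norm_num
  · rw [if_neg (by rw [h]; norm_num), h]; norm_num

/-- `inc` at column `c` is `1` -/
lemma inc_col (hH : IsHadamardMatrix H) (i : ι) : inc H r c i c = 1 := by
  unfold inc; rw [if_pos (nrm_col hH i)]

omit [Fintype ι] [DecidableEq ι] in
/-- `inc` is invariant under a signed automorphism fixing `r` and `c` -/
lemma inc_aut {π κ : Equiv.Perm ι} {d e : ι → ℤ} (haut : IsSignedAut H π κ d e)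
    (hr : π r = r) (hc : κ c = c) (i j : ι) : inc H r c (π i) (κ j) = inc H r c i j := by
  unfold inc; rw [nrm_aut haut hr hc]

/-- **Row sums.** For a Hadamard matrix of order `668` and `i ≠ r`: `Σ_j inc i j = 334`. -/
lemma inc_rowsum_full (hH : IsHadamardMatrix H) (hι : Fintype.card ι = 668) {i : ι} (h : i ≠ r) :
    ∑ j, inc H r c i j = 334 := by
  have e : 2 * ∑ j, inc H r c i j = 668 := by
    rw [Finset.mul_sum, Finset.sum_congr rfl fun j _ => two_mul_inc (r := r) (c := c) hH i j,
      Finset.sum_add_distrib, nrm_rowsum hH h]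
    simp [hι]
  linarith

/-- **Inner products.** For a Hadamard matrix of order `668` and distinct `i, i' ≠ r`: `Σ_j inc i j * inc i' j = 167`. -/
lemma inc_pair_full (hH : IsHadamardMatrix H) (hι : Fintype.card ι = 668) {i i' : ι} (hi : i ≠ r) (hi' : i' ≠ r)
    (h : i ≠ i') : ∑ j, inc H r c i j * inc H r c i' j = 167 := by
  have e : 4 * ∑ j, inc H r c i j * inc H r c i' j = 668 := by
    have key : ∀ j, 4 * (inc H r c i j * inc H r c i' j)
        = 1 + nrm H r c i j + nrm H r c i' j + nrm H r c i j * nrm H r c i' j := by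
      intro j
      have a := two_mul_inc (r := r) (c := c) hH i j
      have b := two_mul_inc (r := r) (c := c) hH i' j
      calc 4 * (inc H r c i j * inc H r c i' j) = (2 * inc H r c i j) * (2 * inc H r c i' j) := by ring
        _ = (1 + nrm H r c i j) * (1 + nrm H r c i' j) := by rw [a, b]
        _ = _ := by ring
    rw [Finset.mul_sum, Finset.sum_congr rfl fun j _ => key j, Finset.sum_add_distrib, Finset.sum_add_distrib,
      Finset.sum_add_distrib, nrm_rowsum hH hi, nrm_rowsum hH hi', nrm_orth hH h]
    simp [hι]
  linarith

end normalise

section transfer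
variable {H : Matrix ι ι ℤ} {r c : ι}

/-- sums over the subtype `{j // j ≠ c}` are sums over `univ.erase c` -/
lemma sum_subtype_ne (f : ι → ℤ) (c : ι) : ∑ y : {j // j ≠ c}, f y.1 = (∑ j, f j) - f c := by
  rw [← Finset.sum_erase_eq_sub (Finset.mem_univ c),
    Finset.sum_subtype (Finset.univ.erase c) (p := fun j => j ≠ c) (fun j => by simp)]

/-- the type `{j // j ≠ c}` has one element fewer -/
lemma card_subtype_ne' (c : ι) : Fintype.card {j // j ≠ c} = Fintype.card ι - 1 := by
  rw [Fintype.card_of_subtype (Finset.univ.erase c) fun x => by simp,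
    Finset.card_erase_of_mem (Finset.mem_univ _), Finset.card_univ]

/-- **Transfer theorem (fixed row and column given).**  A Hadamard matrix of order `668` has no signed automorphism
`(π, κ, d, e)` with `π^p = κ^p = 1`, `π ≠ 1`, `π r = r`, `κ c = c`, for any prime `p ∈ primes106`: the `+1` pattern
of the matrix normalised at `(r, c)`, restricted to `{i ≠ r} × {j ≠ c}`, is a `0/1` structure with `667` blocks, row
sums `333`, inner products `166`, on which `(π, κ)` acts — excluded by `no_automorphism_primes106`. -/
theorem no_hadamard668_signedAut_of_fixed (hH : IsHadamardMatrix H) (hι : Fintype.card ι = 668)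
    (p : ℕ) (hp : p.Prime) (hmem : p ∈ primes106)
    (π κ : Equiv.Perm ι) (d e : ι → ℤ) (haut : IsSignedAut H π κ d e)
    (hπ : π ^ p = 1) (hκ : κ ^ p = 1) (hne : π ≠ 1) (hr : π r = r) (hc : κ c = c) : False := by
  -- the incidence function on the subtypes
  let N : {i // i ≠ r} → {j // j ≠ c} → ℤ := fun x y => inc H r c x.1 y.1
  have h01 : ∀ x y, N x y = 0 ∨ N x y = 1 := fun x y => inc_01 x.1 y.1
  have hrow : ∀ x, ∑ y, N x y = 333 := by
    intro x
    show ∑ y : {j // j ≠ c}, inc H r c x.1 y.1 = 333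
    rw [sum_subtype_ne (fun j => inc H r c x.1 j) c, inc_rowsum_full hH hι x.2, inc_col hH]
    norm_num
  have hpair : ∀ x x', x ≠ x' → ∑ y, N x y * N x' y = 166 := by
    intro x x' hxx'
    have hne' : x.1 ≠ x'.1 := fun h => hxx' (Subtype.ext h)
    show ∑ y : {j // j ≠ c}, inc H r c x.1 y.1 * inc H r c x'.1 y.1 = 166
    rw [sum_subtype_ne (fun j => inc H r c x.1 j * inc H r c x'.1 j) c, inc_pair_full hH hι x.2 x'.2 hne',
      inc_col hH, inc_col hH]
    norm_num
  have hB : Fintype.card {j // j ≠ c} = 667 := by rw [card_subtype_ne', hι]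
  -- the induced permutations
  have hπr : ∀ i, π i ≠ r ↔ i ≠ r := by
    intro i
    constructor
    · intro h hi; exact h (by rw [hi, hr])
    · intro h hi; exact h (π.injective (by rw [hi, hr]))
  have hκc : ∀ j, κ j ≠ c ↔ j ≠ c := by
    intro j
    constructor
    · intro h hj; exact h (by rw [hj, hc])
    · intro h hj; exact h (κ.injective (by rw [hj, hc]))
  let ρ : Equiv.Perm {i // i ≠ r} := π.subtypePerm hπr
  let τ : Equiv.Perm {j // j ≠ c} := κ.subtypePerm hκc
  have hN : ∀ x y, N (ρ x) (τ y) = N x y := by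
    intro x y
    show inc H r c (π x.1) (κ y.1) = inc H r c x.1 y.1
    exact inc_aut haut hr hc x.1 y.1
  have hρ : ρ ^ p = 1 := by
    ext x
    simp [ρ, Equiv.Perm.subtypePerm_pow, hπ]
  have hτ : τ ^ p = 1 := by
    ext y
    simp [τ, Equiv.Perm.subtypePerm_pow, hκ]
  -- a moved point
  obtain ⟨i₀, hi₀⟩ : ∃ i, π i ≠ i := by
    by_contra h
    exact hne (Equiv.ext fun i => not_not.mp (not_exists.mp h i))
  have hi₀r : i₀ ≠ r := fun h => hi₀ (by rw [h, hr])
  have hx₀ : ρ ⟨i₀, hi₀r⟩ ≠ ⟨i₀, hi₀r⟩ := by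
    intro h
    apply hi₀
    have := congrArg Subtype.val h
    simpa [ρ] using this
  exact no_automorphism_primes106 N h01 hrow hpair hB p hp hmem ρ τ hN hρ hτ ⟨i₀, hi₀r⟩ hx₀

set_option maxRecDepth 200000 in
/-- the listed primes other than `167` do not divide `668 = 4 · 167` -/
theorem primes106_not_dvd_668 : ∀ p ∈ primes106, p ≠ 167 → ¬ p ∣ 668 := by decide

set_option maxRecDepth 200000 in
/-- the listed primes are odd -/
theorem primes106_odd : ∀ p ∈ primes106, p % 2 = 1 := by decide

/-- **No Hadamard matrix of order 668 has a nontrivial signed automorphism `(π, κ, d, e)` with `π^p = κ^p = 1`, for any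
of the 105 primes `p ∈ [43, 661] ∖ {47, 83, 167}`.**  ('Nontrivial' = `π ≠ 1 ∨ κ ≠ 1`; for odd `p` the case `π = 1`
forces `κ = 1` by `signedAut_snd_eq_one`.  Fixed row and column exist because `p ∤ 668`.) -/
theorem no_hadamard668_signedAut_primes105 (hH : IsHadamardMatrix H) (hι : Fintype.card ι = 668)
    (p : ℕ) (hp : p.Prime) (hmem : p ∈ primes106) (h167 : p ≠ 167)
    (π κ : Equiv.Perm ι) (d e : ι → ℤ) (haut : IsSignedAut H π κ d e)
    (hπ : π ^ p = 1) (hκ : κ ^ p = 1) (hne : π ≠ 1 ∨ κ ≠ 1) : False := by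
  have hcard : (Fintype.card ι : ℤ) ≠ 0 := by rw [hι]; norm_num
  -- π ≠ 1 (else κ = 1 too)
  have hπ1 : π ≠ 1 := by
    rcases hne with h | h
    · exact h
    · intro hπ1
      apply h
      rw [hπ1] at haut
      have hodd : Odd p := Nat.odd_iff.mpr (primes106_odd p hmem)
      exact signedAut_snd_eq_one H hH hcard haut hodd hκ
  have hnd : ¬ p ∣ Fintype.card ι := by rw [hι]; exact primes106_not_dvd_668 p hmem h167
  haveI : Fact p.Prime := ⟨hp⟩
  obtain ⟨r, hr⟩ := Equiv.Perm.exists_fixed_point_of_prime (n := 1) hnd (σ := π) (by rw [pow_one]; exact hπ)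
  obtain ⟨c, hc⟩ := Equiv.Perm.exists_fixed_point_of_prime (n := 1) hnd (σ := κ) (by rw [pow_one]; exact hκ)
  exact no_hadamard668_signedAut_of_fixed hH hι p hp hmem π κ d e haut hπ hκ hπ1 hr hc

end transfer

end Summit.Ventures.DiscreteObjects.Hadamard
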